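import Summits.AtomisticToContinuum.BoseEinsteinCondensation.Theses.BECInsertionCorrector
import Summits.AtomisticToContinuum.BoseEinsteinCondensation.Theses.BECSectorPoincareTwoScale
import Summits.AtomisticToContinuum.BoseEinsteinCondensation.Theorems.StaticResponseBound.Negative.Basic
import Summits.AtomisticToContinuum.BoseEinsteinCondensation.Theorems.BECInsertionCorrectorStaticResponseBoundSectorFloorToHMinusOne
import Summits.AtomisticToContinuum.BoseEinsteinCondensation.Theorems.BECInsertionCorrectorStaticResponseBoundEnergyFloorToPoincareFloor
import Summits.AtomisticToContinuum.BoseEinsteinCondensation.Theorems.BECInsertionCorrectorStaticResponseBoundGroundStateDiscriminant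
import Summits.AtomisticToContinuum.BoseEinsteinCondensation.Theorems.BECInsertionCorrectorStaticResponseBoundResponseToHyperuniformity
import Summits.AtomisticToContinuum.BoseEinsteinCondensation.Theorems.BECSectorPoincareTwoScaleLandauFloorToSectorGap
import Literature.MathematicalPhysics.QuantumManyBody.GroundStateDirichletForm
import Literature.MathematicalPhysics.QuantumManyBody.WeightedCorrector
import HarnessLib

/-!
# The `fsum-sector-sandwich` calibrations of the static response bound, as kernel theorems

Helper file for the crux `BECInsertionCorrector.StaticResponseBound` (item stmt-AtomisticToContinuum-12057),
line `stable-fraction-square-completion`, skeleton v6 (lead -2).  The planner's brick library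
`Cruxes/StaticResponseBound/Lines/fsum-sector-sandwich.lean` had two sorry-free compositions over four
sorried bricks B1–B4; the bricks are now landed (`stub_sectorFloorToHMinusOne` p98114+p99868,
`stub_energyFloorToPoincareFloor` p97465, `stub_groundStateDiscriminant` p97054,
`stub_responseToHyperuniformity` p97762), so the compositions are theorems with no hypothesis beyond the
one route decl each names:

* H `floorSourced_hMinusOne` — **route bypass**: `LandauSectorBound` (stmt-9091, BY NAME) gives, on the
  infrared window and for every exact real translation-invariant minimiser `Θ` (large `N`, density window),
  the Kipnis–Varadhan datum `hMinusOneSqW L |Θ| (∑ⱼcos(p·xⱼ)) ≤ N/(2θ²ρa)` — the input that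
  `StaticResponseToHMinusOne` (stmt-12060) extracts from the crux for `CorrectorClosure` (stmt-12058),
  sourced here from the sector floor without the crux's energy currency (its `∀t`/all-states content is
  not used by that consumer);
* K `hyperuniformity_of_staticResponseBound` — **kill-edge**: the crux BY NAME gives, for every exact real
  translation-invariant minimiser at `L = (N/ρ)^{1/3}`, `ρ < ρ₀`, EVERY `N ≥ 1`, `k ≠ 0`,
  `(∫V_p²|Θ|²)² ≤ 4(CN/max(ρa,|p|²))·N|p|²/8`, i.e. `S(p) ≤ √(2C)|p|/√max(ρa,|p|²)`: hyperuniformity of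
  torus ground states for all `N` is NECESSARY for the crux.

No new definitions; the statements are adapted verbatim from the planner's file.
-/

namespace Summit.AtomisticToContinuum.BoseEinsteinCondensation.Cruxes.StaticResponseBound.StableFractionSquareCompletion

open MeasureTheory Filter
open scoped ENNReal NNReal
open Literature.MathematicalPhysics.QuantumManyBody.BoseGas
open Summit.AtomisticToContinuum.BoseEinsteinCondensation.Theses
open Summit.AtomisticToContinuum.BoseEinsteinCondensation.Theorems.StaticResponseBound.Negative
  (psq psq_nonneg sideLength_pos)

noncomputable section

/-- The literal sector-floor body of `LandauSectorBound` at one `(N, L, m)` is a floor on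
`momentumSectorEnergy` at `latticeVec (2π/L) m`. [folklore] -/
theorem fsum_momentumSectorEnergy_floor_of_literal (v : ℝ → ℝ≥0∞) (N : ℕ) (L : ℝ) (m : Fin 3 → ℤ)
    (e : ℝ≥0∞)
    (h : ∀ Ψ : PeriodicTrialState N L,
      (∀ (X : Config N) (s : EuclideanSpace ℝ (Fin 3)), Ψ.ψ (fun j => X j + s) =
        Complex.exp (Complex.I * ↑(2 * Real.pi / L * ∑ t : Fin 3, (m t : ℝ) * s t)) * Ψ.ψ X) →
      periodicGroundStateEnergy v N L + e ≤ periodicEnergy v Ψ) :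
    periodicGroundStateEnergy v N L + e ≤ momentumSectorEnergy v N L (latticeVec (2 * Real.pi / L) m) := by
  rw [le_momentumSectorEnergy_iff]
  intro Ψ hΨ
  refine h Ψ fun X s => ?_
  have := hΨ s X
  rw [Summit.AtomisticToContinuum.BoseEinsteinCondensation.Theorems.LandauFloorToSectorGap.sum_latticeVec_mul] at this
  exact this

/-- **H — the floor-sourced `H₋₁` datum (route bypass).** `LandauSectorBound` (stmt-9091, BY NAME) implies, on
the infrared window `|p| ≤ M₀√(ρa)`, for every real non-negative translation-invariant exact minimiser `Θ` of the
periodic `N`-body energy (N large, `ρ/2 ≤ N/L³ ≤ 2ρ`): `hMinusOneSqW L |Θ| (∑ⱼ cos(p·xⱼ)) ≤ N/(2θ²ρa)` — by B4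
(energy floor ⇒ Poincaré floor) and B1 (the sandwich `m₋₁ ≤ m₁/ω²`). [cite: Stringari1995, §3 (40)] -/
theorem floorSourced_hMinusOne :
    _root_.Summit.AtomisticToContinuum.BoseEinsteinCondensation.Theses.BECSectorPoincareTwoScale.LandauSectorBound →
    ∀ v : ℝ → ℝ≥0∞, IsRepulsiveFiniteRange v → ∀ M₀ : ℝ, 0 < M₀ → ∃ θ : ℝ, 0 < θ ∧ ∃ ρ₀ : ℝ, 0 < ρ₀ ∧
      ∀ ρ : ℝ, 0 < ρ → ρ < ρ₀ → ∀ᶠ N : ℕ in Filter.atTop, ∀ L : ℝ, 0 < L →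
        ρ / 2 ≤ (N : ℝ) / L ^ 3 → (N : ℝ) / L ^ 3 ≤ 2 * ρ → ∀ m : Fin 3 → ℤ, m ≠ 0 →
          2 * Real.pi / L * ‖(WithLp.toLp 2 fun t => (m t : ℝ) : EuclideanSpace ℝ (Fin 3))‖ ≤
              M₀ * Real.sqrt (ρ * (scatteringLength v).toReal) →
          ∀ Θ : PeriodicTrialState N L, (∀ X, Θ.ψ X = (‖Θ.ψ X‖ : ℂ)) → HasTotalMomentum 0 Θ.ψ →
            periodicEnergy v Θ = periodicGroundStateEnergy v N L → periodicEnergy v Θ ≠ ⊤ →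
            hMinusOneSqW L (fun X => ‖Θ.ψ X‖)
                (fun X => ∑ j, Real.cos (2 * Real.pi / L * ∑ i, (m i : ℝ) * X j i)) ≤
              ENNReal.ofReal (N / (2 * θ ^ 2 * (ρ * (scatteringLength v).toReal))) := by
  intro hLandau v hv M₀ hM₀
  obtain ⟨θ, hθ, ρ₀, hρ₀, hfloor⟩ := hLandau v hv M₀ hM₀
  refine ⟨θ, hθ, ρ₀, hρ₀, fun ρ hρ hρρ₀ => ?_⟩
  filter_upwards [hfloor ρ hρ hρρ₀] with N hN
  intro L hL hw₁ hw₂ m hm hkM Θ hreal htr hmin hfin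
  set a : ℝ := (scatteringLength v).toReal with ha_def
  set kk : ℝ := 2 * Real.pi / L * ‖(WithLp.toLp 2 fun t => (m t : ℝ) : EuclideanSpace ℝ (Fin 3))‖
    with hkk_def
  set ω : ℝ := θ * Real.sqrt (ρ * a) * kk with hω_def
  have hlit := hN L hL hw₁ hw₂ m hm hkM
  have hm' : (WithLp.toLp 2 fun t => (m t : ℝ) : EuclideanSpace ℝ (Fin 3)) ≠ 0 := by
    intro h0
    apply hm
    funext t
    have := congrArg (fun x : EuclideanSpace ℝ (Fin 3) => x t) h0
    simpa using this
  have hkkpos : 0 < kk := by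
    rw [hkk_def]
    exact mul_pos (by positivity) (norm_pos_iff.mpr hm')
  have hsqrtpos : 0 < Real.sqrt (ρ * a) := by
    by_contra hle
    push Not at hle
    have : kk ≤ 0 := hkM.trans (by nlinarith [hM₀.le])
    linarith
  have hρa : 0 < ρ * a := Real.sqrt_pos.mp hsqrtpos
  have hωpos : 0 < ω := by rw [hω_def]; positivity
  have hsec : periodicGroundStateEnergy v N L + ENNReal.ofReal ω ≤
      momentumSectorEnergy v N L (latticeVec (2 * Real.pi / L) m) :=
    fsum_momentumSectorEnergy_floor_of_literal v N L m (ENNReal.ofReal ω) hlit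
  have hP : ENNReal.ofReal ω ≤ sectorPoincareConstant L Θ.ψ (latticeVec (2 * Real.pi / L) m) :=
    stub_energyFloorToPoincareFloor v N L hL Θ hreal htr hmin hfin m ω hωpos.le hsec
  have hB1 := stub_sectorFloorToHMinusOne N L hL m Θ htr ω hωpos hP
  refine hB1.trans (le_of_eq ?_)
  have hnorm : ‖(WithLp.toLp 2 fun t => (m t : ℝ) : EuclideanSpace ℝ (Fin 3))‖ ^ 2 =
      ∑ i, (m i : ℝ) ^ 2 := by
    rw [EuclideanSpace.norm_eq, Real.sq_sqrt (Finset.sum_nonneg fun i _ => by positivity)]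
    exact Finset.sum_congr rfl fun i _ => by simp [sq_abs]
  have hpsq : (2 * Real.pi / L) ^ 2 * ∑ i, (m i : ℝ) ^ 2 = kk ^ 2 := by
    rw [hkk_def, mul_pow, hnorm]
  have hω2 : ω ^ 2 = θ ^ 2 * (ρ * a) * kk ^ 2 := by
    rw [hω_def, mul_pow, mul_pow, Real.sq_sqrt hρa.le]
  congr 1
  rw [hpsq, hω2]
  have hkk0 : kk ^ 2 ≠ 0 := pow_ne_zero 2 hkkpos.ne'
  have hθ0 : θ ^ 2 ≠ 0 := pow_ne_zero 2 hθ.ne'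
  have hρa0 : ρ * a ≠ 0 := hρa.ne'
  field_simp


/-- **K — the kill-edge.** `StaticResponseBound` (BY NAME) implies, for every exact real non-negative
translation-invariant minimiser `Θ` at `L = (N/ρ)^{1/3}`, `ρ < ρ₀(v)`, every `N ≥ 1`, `k ≠ 0`:
`(∫ V_p² |Θ|²)² ≤ 4 (CN/max(ρa,|p|²)) · N|p|²/8` (B3: all-states discriminant; B2: test `1 + εV_p`), i.e. with
`∫V_p²|Θ|² = N S(p)/2`: `S(p) ≤ √(2C)|p|/√max(ρa,|p|²)` — refute this hyperuniformity at one admissible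
`(ρ, N, k)` for every `C` and the crux is false. [cite: Stringari1995, §3 (40)] -/
theorem hyperuniformity_of_staticResponseBound :
    _root_.Summit.AtomisticToContinuum.BoseEinsteinCondensation.Theses.BECInsertionCorrector.StaticResponseBound →
    ∀ v : ℝ → ℝ≥0∞, IsRepulsiveFiniteRange v → ∃ ρ₀ : ℝ, 0 < ρ₀ ∧ ∃ C : ℝ, 0 < C ∧
      ∀ ρ : ℝ, 0 < ρ → ρ < ρ₀ → ∀ N : ℕ, 0 < N → ∀ k : Fin 3 → ℤ, k ≠ 0 →
        ∀ Θ : PeriodicTrialState N (sideLength ρ N), (∀ X, Θ.ψ X = (‖Θ.ψ X‖ : ℂ)) →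
          HasTotalMomentum 0 Θ.ψ →
          periodicEnergy v Θ = periodicGroundStateEnergy v N (sideLength ρ N) →
          periodicEnergy v Θ ≠ ⊤ →
          (∫ X in cellN N (sideLength ρ N),
              (∑ j, Real.cos (2 * Real.pi / sideLength ρ N * ∑ i, (k i : ℝ) * X j i)) ^ 2 *
                ‖Θ.ψ X‖ ^ 2) ^ 2 ≤
            4 * (C * N / max (ρ * (scatteringLength v).toReal) (psq (sideLength ρ N) k)) *
              (N * psq (sideLength ρ N) k / 8) := by
  intro hS v hv
  obtain ⟨ρ₀, hρ₀, C, hC, hbody⟩ := hS v hv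
  refine ⟨ρ₀, hρ₀, C, hC, ?_⟩
  intro ρ hρ hρρ₀ N hN k hk Θ hreal htr hmin hfin
  have hL : 0 < sideLength ρ N := sideLength_pos hρ hN
  have hM0 : 0 ≤ max (ρ * (scatteringLength v).toReal) (psq (sideLength ρ N) k) :=
    le_max_of_le_right (by unfold psq; positivity)
  have hB0 : 0 ≤ C * N / max (ρ * (scatteringLength v).toReal) (psq (sideLength ρ N) k) :=
    div_nonneg (by positivity) hM0
  have hbody' : ∀ (t : ℝ) (Ψ : PeriodicTrialState N (sideLength ρ N)), periodicEnergy v Ψ ≠ ⊤ →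
      (periodicGroundStateEnergy v N (sideLength ρ N)).toReal -
          C * N / max (ρ * (scatteringLength v).toReal) (psq (sideLength ρ N) k) * t ^ 2 ≤
        (periodicEnergy v Ψ).toReal +
          t * ∫ X in cellN N (sideLength ρ N),
            (∑ j, Real.cos (2 * Real.pi / sideLength ρ N * ∑ i, (k i : ℝ) * X j i)) *
              ‖Ψ.ψ X‖ ^ 2 := by
    intro t Ψ hΨ
    have h := hbody ρ hρ hρρ₀ N k hk t Ψ hΨ
    have hrw : C * t ^ 2 * (N : ℝ) / max (ρ * (scatteringLength v).toReal)
        ((2 * Real.pi / sideLength ρ N) ^ 2 * ∑ i, (k i : ℝ) ^ 2) =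
        C * N / max (ρ * (scatteringLength v).toReal) (psq (sideLength ρ N) k) * t ^ 2 := by
      rw [psq]
      ring
    rw [hrw] at h
    exact h
  have hdisc := stub_groundStateDiscriminant v N (sideLength ρ N) hL Θ hreal hmin hfin k _ hB0 hbody'
  exact stub_responseToHyperuniformity N (sideLength ρ N) hL k hk Θ htr _ (mul_nonneg (by norm_num) hB0) hdisc


end

end Summit.AtomisticToContinuum.BoseEinsteinCondensation.Cruxes.StaticResponseBound.StableFractionSquareCompletion
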